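import Summits.AtomisticToContinuum.Crystallization.Theorems.FrustratedLawDichotomyStrainedPatchRecutBuild

/-!
# The g54 record: pinned recut families and the ten-binder node, in two pin sets (lens-5 g54, file P)

Crux 27623 (T-side), node [CORE-FAR] `CoreOffTubeFloor (63/10) (63/10) (24/5) (1/100) 0`.  The family-parametric machinery is `…RecutPairs` (K); this file PINS it.
Two pin sets, the critic rules which is of record (NODE-g54 §10):
* §A — over the g53 families: chart family `𝓘₀ᴿ := bentFamily 𝓑₀ (1/16) ∩ InteriorChart 𝓑₀ β₀ ς₀ s₀`, comparison family `𝓘₁⁺ = CompFamily1`; (T2-bent₁) consumed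
  VERBATIM (PROVED, g53 J); the g53 table leaves imply the paired ones (`…_of_certBent1`, `…_of_dominationBent1`, `…_of_membershipBent1`); node ★★★
  `coreOff_record_g54`.  Affected by the RIM CRACK (`…WindowFamilies`): the `∃`-pieces (F2ᴿ-bent₀) and (RFᴿ-bent₁) must deliver instances meeting the
  bent-radius clause `≤ 133/10` at a skeleton-cut rim — realisable for UNBENT charts, for bent ones only with an inward-cubic discipline paid from the fine budget.
* §B — over the WINDOW-HONEST families (of record, critic row 994): `𝓘₀ᴿʷ := bentFamilyW 𝓑₀ (1/16) ∩ InteriorChartW 𝓑₀ β₀ ς₀ s₀` (the window-honest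
  footprint of `…RecutBuild`: separation clause on the bent `16`-window, which covers every site a recut can have), `𝓘₁ʷ = CompFamilyW` (radius clause `16`,
  automatic from `IsBentBall`); (T2ʷ) is the binder (PROVED by the rename re-run, `…WindowTaylorTail.taylorTwoBentW_holds`; it implies (T2-bent₁)); the
  table pieces are re-instrumented over the W families (same instruments: nothing they measure sees the rim); node ★★★ `coreOff_record_g54W`.  Here
  (RFᴿ-bentW)'s instance half is BUILT (`exists_recut_chartFamilyRW`: recut instance, `RecutNear`, injective, separated, `𝓑₁`-bent, in `𝓘₁ʷ` once good —
  `…RecutBuild`) and (F2ᴿ-bentW0)'s chooser is rim-free (`bentFamilyW_of_sepBent`).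
No sorry, no new axioms, no cite tokens, no instances / notation.
-/

namespace Summit.AtomisticToContinuum.Crystallization.Theorems.FrustratedLawDichotomyStrainedPatchRecutRecord


open scoped BigOperators Classical
open Summit.AtomisticToContinuum.Crystallization.Theorems.FrustratedLawDichotomyPeriodicBlockFlags (goodAtScale_mono)
open Summit.AtomisticToContinuum.Crystallization.Theorems.FrustratedLawDichotomyRangeCut (Sep)
open Summit.AtomisticToContinuum.Crystallization.Theorems.FrustratedLawDichotomyMotifLemmas
open Summit.AtomisticToContinuum.Crystallization.Theorems.FrustratedLawDichotomyAveragingCut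
open Summit.AtomisticToContinuum.Crystallization.Theorems.FrustratedLawDichotomyAveragingRuleCap
open Summit.AtomisticToContinuum.Crystallization.Theorems.FrustratedLawDichotomyAveragingRuleTightFree
open Summit.AtomisticToContinuum.Crystallization.Theorems.FrustratedLawDichotomyExemptDoor (SitePred)
open Summit.AtomisticToContinuum.Crystallization.Theorems.FrustratedLawDichotomyExemptAbsorption
open Summit.AtomisticToContinuum.Crystallization.Theorems.FrustratedLawDichotomyExemptAbsorptionRecord
open Summit.AtomisticToContinuum.Crystallization.Theorems.FrustratedLawDichotomyCollarCensus
open Summit.AtomisticToContinuum.Crystallization.Theorems.FrustratedLawDichotomyCollarCensusKappa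
open Summit.AtomisticToContinuum.Crystallization.Theorems.FrustratedLawDichotomyStrainedPatchHomSplit
open Summit.AtomisticToContinuum.Crystallization.Theorems.FrustratedLawDichotomyStrainedPatchCleanCollar
open Summit.AtomisticToContinuum.Crystallization.Theorems.FrustratedLawDichotomyStrainedPatchHomTube
open Summit.AtomisticToContinuum.Crystallization.Theorems.FrustratedLawDichotomyStrainedPatchHomIsometry
open Summit.AtomisticToContinuum.Crystallization.Theorems.FrustratedLawDichotomyStrainedPatchHomTubeIso
open Summit.AtomisticToContinuum.Crystallization.Theorems.FrustratedLawDichotomyStrainedPatchPhaseCut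
open Summit.AtomisticToContinuum.Crystallization.Theorems.FrustratedLawDichotomyStrainedPatchCoreTube
open Summit.AtomisticToContinuum.Crystallization.Theorems.FrustratedLawDichotomyStrainedPatchCoreTubeRecord
open Summit.AtomisticToContinuum.Crystallization.Theorems.FrustratedLawDichotomyStrainedPatchCoreTubeMilli
open Summit.AtomisticToContinuum.Crystallization.Theorems.FrustratedLawDichotomyStrainedPatchStrainBands
open Summit.AtomisticToContinuum.Crystallization.Theorems.FrustratedLawDichotomyStrainedPatchChartFamilies
open Summit.AtomisticToContinuum.Crystallization.Theorems.FrustratedLawDichotomyStrainedPatchChartFamiliesBent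
open Summit.AtomisticToContinuum.Crystallization.Theorems.FrustratedLawDichotomyStrainedPatchChartFamiliesPinned
open Summit.AtomisticToContinuum.Crystallization.Theorems.FrustratedLawDichotomyStrainedPatchEnvelopeLaw
open Summit.AtomisticToContinuum.Crystallization.Theorems.FrustratedLawDichotomyStrainedPatchEnvelopeTaylor
open Literature.Barriers.AtomisticToContinuum.FlatleyTheil2015 (fccVec)
open Summit.AtomisticToContinuum.Crystallization.Theorems.FrustratedLawDichotomyStrainedPatchRecutPairs
open Summit.AtomisticToContinuum.Crystallization.Theorems.FrustratedLawDichotomyStrainedPatchRecutKinematics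
open Summit.AtomisticToContinuum.Crystallization.Theorems.FrustratedLawDichotomyStrainedPatchWindowFamilies
open Summit.AtomisticToContinuum.Crystallization.Theorems.FrustratedLawDichotomyStrainedPatchRecutBuild

/-! ## §A. Pins over the g53 families (`bentFamily 𝓑₀ (1/16)`, `𝓘₁⁺`) — (T2-bent₁) verbatim; rim-cracked on the `∃` side -/

/-- ★ **THE CHART FAMILY OF g54 `𝓘₀ᴿ`** := the g53 chart family `bentFamily 𝓑₀ (1/16)` ∩ `InteriorChart 𝓑₀ β₀ ς₀ s₀` (so that the RECUT IMAGES — same `ξ`,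
matrix within `1/120` — form exactly the subfamily `𝓘₁ʳ = {‖ξ‖ ≤ 1/10, ‖G − 1‖ ≤ 0.19}` of critic row 982 (b), tied to their charts). -/
def ChartFamilyR : (M₀ : ℕ) → (Fin M₀ → E3) → Fin M₀ → Prop :=
  fun M₀ z₀ c₀ => bentFamily bends0 eta00 M₀ z₀ c₀ ∧ InteriorChart bends0 beta0 xi0 sep0 z₀ c₀

/-- `𝓘₀ᴿ ≤` the g53 chart family. [formal bookkeeping] -/
theorem chartFamilyR_le : FamilyLE ChartFamilyR (bentFamily bends0 eta00) := fun _ _ _ h => h.1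

/-- ★ **(RFᴿ-bent₁)** `:= AffineRecut 𝓘₀ᴿ 𝓘₁⁺ 𝓑₀ (1/4) (7/20) (1/3) (2/5) T₀` [KINEMATIC · instance half: recut construction, conjugate bend ∈ 𝓑₁, interior
slack; least-squares half: `‖A_LS‖ ≤ κL₀·t` (measured `≤ 0.316·t`), level shift `≤ t/3` (census KAPPA-N)]. -/
def RecutBent1 : Prop := AffineRecut ChartFamilyR CompFamily1 bends0 tau0 tau1 kN1 kL0 T0

/-- ★ **(ENVᴿ-bent₁ Ψ)** `:= PairedEnvelopeOn projectedFree 𝓘₀ᴿ 𝓘₁⁺ 𝓑₀ (1/4) (7/20) (2/5) T₀ Ψ` — decomposed at level 2 (§2). -/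
def EnvelopeRBent1 (Ψ : (M₁ : ℕ) → (Fin M₁ → E3) → Fin M₁ → ℝ → ℝ) : Prop :=
  PairedEnvelopeOn projectedFree ChartFamilyR CompFamily1 bends0 tau0 tau1 kL0 T0 Ψ

/-- ★ **(DOMᴿ-bent₁ Ψ)** `:= RecutDomination 𝓘₀ᴿ 𝓘₁⁺ 𝓑₀ (1/3) (2/5) T₀ Ψ Φ₁` [TABLE CERTIFICATE · INSTRUMENTABLE: BUDGET54 = BUDGET53 on (chart box) × (recut
ball), tables switched on the chart's fitted phase]. -/
def DominationRBent1 (Ψ : (M₁ : ℕ) → (Fin M₁ → E3) → Fin M₁ → ℝ → ℝ) : Prop := RecutDomination ChartFamilyR CompFamily1 bends0 kN1 kL0 T0 Ψ Phi1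

/-- ★ **(F1ᴿ-cap-bent₁)** `:= FamilyEnvelopeRecutCap 𝓘₀ᴿ 𝓘₁⁺ 𝓑₀ (1/4) (1/3) (2/5) Φ₁ T₀`. -/
def FamilyEnvelopeCapRBent1 : Prop := FamilyEnvelopeRecutCap ChartFamilyR CompFamily1 bends0 tau0 kN1 kL0 Phi1 T0

/-- ★ **(F2ᴿ-bent₀)** `:= FamilyRoom 𝓘₀ᴿ (24/5) (1/100) (3/50) (1/4) T₀` [GEOMETRIC · INSTRUMENTABLE: (F2-bent₀) plus three columns — the fitted chart of a
far-class host has an interior presentation (`‖G₀ − 1‖ ≤ 9/50`, `‖ξ₀‖ ≤ 1/10`) whose bent lattice is `3/4`-separated on the `27/2`-window; census FOOTPRINT27 puts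
admissible chart centres at strain `≤ 0.132`, `‖ξ‖ ≤ 0.053`, `d ≥ 0.877`]. -/
def FamilyRoomRBent0 : Prop := FamilyRoom ChartFamilyR (24 / 5) (1 / 100) etaE tau0 T0

/-- ★ **(F3ᴿ-bent₁)** `:= FamilyCertRecut 𝓘₀ᴿ 𝓘₁⁺ 𝓑₀ (1/3) (2/5) 0 Φ₁ T₀` [TABLE CERTIFICATE over recut pairs · INSTRUMENTABLE]. -/
def FamilyCertRBent1 : Prop := FamilyCertRecut ChartFamilyR CompFamily1 bends0 kN1 kL0 0 Phi1 T0

/-- ★ **(BASᴿ-bent₁)** `:= PairedBasin projectedFree 𝓘₀ᴿ 𝓘₁⁺ 𝓑₀ (1/4) (7/20) (2/5) T₀ (1/20)` [ANALYTIC · UNDECIDED · INSTRUMENTABLE: census BASIN]. -/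
def BasinRBent1 : Prop := PairedBasin projectedFree ChartFamilyR CompFamily1 bends0 tau0 tau1 kL0 T0 delta0

/-- ★ **(MEMᴿ-bent₁ μ)** `:= PairedMembership 𝓘₀ᴿ 𝓘₁⁺ 𝓑₀ (1/4) (7/20) (2/5) T₀ (1/20) μ` [INSTRUMENTABLE: census MU on (chart box) × (recut ball)]. -/
def MembershipRBent1 (μ : (M₁ : ℕ) → (Fin M₁ → E3) → Fin M₁ → ℝ) : Prop := PairedMembership ChartFamilyR CompFamily1 bends0 tau0 tau1 kL0 T0 delta0 μ

/-- ★ **(LINᴿ-bent₁ Ψ)** `:= PairedSlaved projectedFree 𝓘₀ᴿ 𝓘₁⁺ 𝓑₀ (1/4) (7/20) (2/5) T₀ (1/20) G₀ w₀ Ψ` [MECHANICS · UNDECIDED · INSTRUMENTABLE: census LIN]. -/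
def SlavedRBent1 (Ψ : (M₁ : ℕ) → (Fin M₁ → E3) → Fin M₁ → ℝ → ℝ) : Prop :=
  PairedSlaved projectedFree ChartFamilyR CompFamily1 bends0 tau0 tau1 kL0 T0 delta0 G0 w0 Ψ

/-- THE TRADE g53 → g54 on (F3): (F3-bent₁) ⟹ (F3ᴿ-bent₁). [formal bookkeeping] -/
theorem familyCertRBent1_of_certBent1 (h : FamilyCertBent1) : FamilyCertRBent1 := familyCertRecut_of_certRefit h chartFamilyR_le

/-- THE TRADE g53 → g54 on (DOM): (DOM-bent₁ Ψ) ⟹ (DOMᴿ-bent₁ Ψ). [formal bookkeeping] -/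
theorem dominationRBent1_of_dominationBent1 {Ψ : (M₁ : ℕ) → (Fin M₁ → E3) → Fin M₁ → ℝ → ℝ} (h : DominationBent1 Ψ) : DominationRBent1 Ψ :=
  recutDomination_of_refitDomination h chartFamilyR_le

/-- THE TRADE g53 → g54 on (MEM): (MEM-bent₁ μ) ⟹ (MEMᴿ-bent₁ μ). [formal bookkeeping] -/
theorem membershipRBent1_of_membershipBent1 {μ : (M₁ : ℕ) → (Fin M₁ → E3) → Fin M₁ → ℝ} (h : MembershipBent1 μ) : MembershipRBent1 μ :=
  pairedMembership_of_membershipColumn h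

/-- THE TRADE g54 → g53 on (F2) (the interior pins cost (F2), nothing else): (F2ᴿ-bent₀) ⟹ (F2-bent₀). [formal bookkeeping] -/
theorem familyRoomBent0_of_roomR (h : FamilyRoomRBent0) : FamilyRoomBent0 := by
  intro M z c hz hcl hm hn hg
  obtain ⟨R, M₀, z₀, c₀, e, ht, hch⟩ := h M z c hz hcl hm hn hg
  exact ⟨R, M₀, z₀, c₀, e, ht, chartFamilyR_le M₀ z₀ c₀ hch.1, hch.2⟩

/-- ★★ LEVEL-2 NODE OF g54: (BASᴿ-bent₁) ∧ (T2-bent₁) [VERBATIM, PROVED in g53 J] ∧ (MEMᴿ-bent₁ μ) ∧ (LINᴿ-bent₁ Ψ) ⟹ (ENVᴿ-bent₁ (Ψ + ϱ₀ + μ)). [folklore] -/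
theorem envelopeRBent1_of_taylor {Ψ : (M₁ : ℕ) → (Fin M₁ → E3) → Fin M₁ → ℝ → ℝ} {μ : (M₁ : ℕ) → (Fin M₁ → E3) → Fin M₁ → ℝ} (hB : BasinRBent1)
    (hT : TaylorTwoBent1) (hM : MembershipRBent1 μ) (hL : SlavedRBent1 Ψ) : EnvelopeRBent1 (withColumns Ψ μ) :=
  pairedEnvelopeOn_of_taylor hB hT hM hL

/-- ★★ LEVEL-1 NODE OF g54: (RFᴿ-bent₁) ∧ (ENVᴿ-bent₁ Ψ) ∧ (DOMᴿ-bent₁ Ψ) ⟹ (F1ᴿ-cap-bent₁). [folklore] -/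
theorem familyEnvelopeCapRBent1_of_pieces {Ψ : (M₁ : ℕ) → (Fin M₁ → E3) → Fin M₁ → ℝ → ℝ} (hRF : RecutBent1) (hE : EnvelopeRBent1 Ψ)
    (hD : DominationRBent1 Ψ) : FamilyEnvelopeCapRBent1 :=
  familyEnvelopeRecutCap_of_pieces hRF hE hD

/-- ★★ LEVEL-0 NODE OF g54, EDGE BAND: (F1ᴿ-cap-bent₁) ∧ (F2ᴿ-bent₀) ∧ (F3ᴿ-bent₁) ⟹ `EdgeFarFloor (63/10) (63/10) (24/5) (1/100) (3/50) 0`. [folklore] -/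
theorem edgeFar_capRBent1 (hE : FamilyEnvelopeCapRBent1) (hR : FamilyRoomRBent0) (hC : FamilyCertRBent1) :
    EdgeFarFloor (63 / 10) (63 / 10) (24 / 5) (1 / 100) (3 / 50) 0 :=
  edgeFar_of_familyRecutCap hE hR hC

/-- ★★★ THE g54 NODE OF RECORD (levels 2 + 1 + 0 on recut pairs, ten binders, every seam proved): for any tables `Ψ, μ`,
(BASᴿ-bent₁) ∧ (T2-bent₁ ✓ J) ∧ (MEMᴿ-bent₁ μ) ∧ (LINᴿ-bent₁ Ψ) ∧ (RFᴿ-bent₁) ∧ (DOMᴿ-bent₁ (Ψ+ϱ₀+μ)) ∧ (F2ᴿ-bent₀) ∧ (F3ᴿ-bent₁) ∧ [BRIDGE]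
`BandFarFloor … (3/50) (1/10) 0` ∧ [SOFT-FAR] `SoftFarFloor … (1/10) 0` ⟹ [CORE-FAR] `CoreOffTubeFloor (63/10) (63/10) (24/5) (1/100) 0`. [folklore] -/
theorem coreOff_record_g54 {Ψ : (M₁ : ℕ) → (Fin M₁ → E3) → Fin M₁ → ℝ → ℝ} {μ : (M₁ : ℕ) → (Fin M₁ → E3) → Fin M₁ → ℝ}
    (hB : BasinRBent1) (hT : TaylorTwoBent1) (hM : MembershipRBent1 μ) (hL : SlavedRBent1 Ψ) (hRF : RecutBent1)
    (hD : DominationRBent1 (withColumns Ψ μ)) (hR : FamilyRoomRBent0) (hC : FamilyCertRBent1)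
    (hBand : BandFarFloor (63 / 10) (63 / 10) (24 / 5) (1 / 100) (3 / 50) (1 / 10) 0) (hS : SoftFarFloor (63 / 10) (63 / 10) (24 / 5) (1 / 100) (1 / 10) 0) :
    CoreOffTubeFloor (63 / 10) (63 / 10) (24 / 5) (1 / 100) 0 :=
  coreOff_of_familyRecutCap_of_band_of_soft (familyEnvelopeCapRBent1_of_pieces hRF (envelopeRBent1_of_taylor hB hT hM hL) hD) hR hC hBand hS

/-- ★★ The EDGE band alone (no bridge, no residual): the eight pieces ⟹ `EdgeFarFloor (63/10) (63/10) (24/5) (1/100) (3/50) 0`. [folklore] -/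
theorem edgeFar_record_g54 {Ψ : (M₁ : ℕ) → (Fin M₁ → E3) → Fin M₁ → ℝ → ℝ} {μ : (M₁ : ℕ) → (Fin M₁ → E3) → Fin M₁ → ℝ}
    (hB : BasinRBent1) (hT : TaylorTwoBent1) (hM : MembershipRBent1 μ) (hL : SlavedRBent1 Ψ) (hRF : RecutBent1)
    (hD : DominationRBent1 (withColumns Ψ μ)) (hR : FamilyRoomRBent0) (hC : FamilyCertRBent1) :
    EdgeFarFloor (63 / 10) (63 / 10) (24 / 5) (1 / 100) (3 / 50) 0 :=
  edgeFar_capRBent1 (familyEnvelopeCapRBent1_of_pieces hRF (envelopeRBent1_of_taylor hB hT hM hL) hD) hR hC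

/-- ★ THE DOCKET TRADE: with the three g53 INSTRUMENTABLE leaves (F3-bent₁), (DOM-bent₁), (MEM-bent₁) in hand the g54 node needs only their images; i.e. the
g53 census instruments (BUDGET53, MU) discharge the g54 binders a fortiori. [formal bookkeeping] -/
theorem coreOff_record_g54_of_g53_tables {Ψ : (M₁ : ℕ) → (Fin M₁ → E3) → Fin M₁ → ℝ → ℝ} {μ : (M₁ : ℕ) → (Fin M₁ → E3) → Fin M₁ → ℝ}
    (hB : BasinRBent1) (hT : TaylorTwoBent1) (hM : MembershipBent1 μ) (hL : SlavedRBent1 Ψ) (hRF : RecutBent1)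
    (hD : DominationBent1 (withColumns Ψ μ)) (hR : FamilyRoomRBent0) (hC : FamilyCertBent1)
    (hBand : BandFarFloor (63 / 10) (63 / 10) (24 / 5) (1 / 100) (3 / 50) (1 / 10) 0) (hS : SoftFarFloor (63 / 10) (63 / 10) (24 / 5) (1 / 100) (1 / 10) 0) :
    CoreOffTubeFloor (63 / 10) (63 / 10) (24 / 5) (1 / 100) 0 :=
  coreOff_record_g54 hB hT (membershipRBent1_of_membershipBent1 hM) hL hRF (dominationRBent1_of_dominationBent1 hD) hR
    (familyCertRBent1_of_certBent1 hC) hBand hS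


/-! ## §B. Pins over the window-honest families (`bentFamilyW 𝓑₀ (1/16)`, `𝓘₁ʷ`) — recommended; (T2ʷ) by the rename re-run -/

/-- ★ **THE CHART FAMILY OF g54 (W) `𝓘₀ᴿʷ`** := the window-honest chart family `bentFamilyW 𝓑₀ (1/16)` ∩ the window-honest footprint `InteriorChartW 𝓑₀ β₀ ς₀ s₀`
of `…RecutBuild` (separation clause on the bent `16`-window; so that the RECUT IMAGES — same `ξ`, matrix within `1/120` — form exactly the subfamily
`𝓘₁ʳ = {‖ξ‖ ≤ 1/10, ‖G − 1‖ ≤ 0.19}` of critic row 982 (b), tied to their charts, and are `7/10`-separated at EVERY site). -/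
def ChartFamilyRW : (M₀ : ℕ) → (Fin M₀ → E3) → Fin M₀ → Prop :=
  fun M₀ z₀ c₀ => bentFamilyW bends0 eta00 M₀ z₀ c₀ ∧ InteriorChartW bends0 beta0 xi0 sep0 z₀ c₀

/-- `𝓘₀ᴿʷ ≤` the window-honest chart family. [formal bookkeeping] -/
theorem chartFamilyRW_le : FamilyLE ChartFamilyRW (bentFamilyW bends0 eta00) := fun _ _ _ h => h.1

/-- A chart of `𝓘₀ᴿʷ` carries the `…RecutPairs` footprint too (`InteriorChartW → InteriorChart`). [formal bookkeeping] -/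
theorem interiorChart_of_chartFamilyRW {M₀ : ℕ} {z₀ : Fin M₀ → E3} {c₀ : Fin M₀} (h : ChartFamilyRW M₀ z₀ c₀) : InteriorChart bends0 beta0 xi0 sep0 z₀ c₀ :=
  interiorChart_of_W h.2

/-- ★★ **(RFᴿ-bentW), INSTANCE HALF, BUILT** (step (R2)): every chart `z₀ ∈ 𝓘₀ᴿʷ` admits, for every fine parameter `0 ≤ t ≤ T₀(z₀)` (`≤ 1/60` at its
`1/16`-good centre), every `‖A‖ ≤ κL₀·t` and every base point `y`, a recut instance centred at `y` that is `RecutNear 𝓑₀ κL₀ t` the chart, injective,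
`7/10`-separated, a `𝓑₁`-bent `133/10`-ball, and a member of `𝓘₁ʷ` as soon as its centre is `η₃₀`-good (`…RecutBuild.exists_recut_of_interiorChartW`).  What (RFᴿ-bentW)
still asks beyond this: `A = A_LS` with `‖A_LS‖ ≤ κL₀·t` and `projectedFree` (R1), the coarse chart `τ₁` (R5), `LevelNear (1/3)` (R6), the goodness (R7). [folklore] -/
theorem exists_recut_chartFamilyRW {M₀ : ℕ} {z₀ : Fin M₀ → E3} {c₀ : Fin M₀} (h : ChartFamilyRW M₀ z₀ c₀) {t : ℝ} (ht : 0 ≤ t) (ht' : t ≤ T0 M₀ z₀ c₀)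
    (A : E3 →L[ℝ] E3) (hA : ‖A‖ ≤ kL0 * max t 0) (y : E3) :
    ∃ (M₁ : ℕ) (z₁ : Fin M₁ → E3) (c₁ : Fin M₁), z₁ c₁ = y ∧ RecutNear bends0 kL0 t z₀ c₀ z₁ c₁ ∧ Function.Injective z₁ ∧ Sep z₁ ∧
      IsBentBall bends1 (133 / 10) z₁ c₁ ∧ (GoodAtScale eta30 (3 / 2) z₁ c₁ → CompFamilyW M₁ z₁ c₁) := by
  obtain ⟨M₁, z₁, c₁, hy, hRN, hinj, hsep, hbent, hmem, -⟩ :=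
    exists_recut_of_interiorChartW h.2 ht (ht'.trans (T0_le_of_goodAtScale h.1.2.2)) A hA y
  exact ⟨M₁, z₁, c₁, hy, hRN, hinj, hsep, hbent, hmem⟩

/-- ★ **(RFᴿ-bentW)** `:= AffineRecut 𝓘₀ᴿʷ 𝓘₁ʷ 𝓑₀ (1/4) (7/20) (1/3) (2/5) T₀` [KINEMATIC · instance half: recut construction, conjugate bend ∈ 𝓑₁, interior
slack; least-squares half: `‖A_LS‖ ≤ κL₀·t` (measured `≤ 0.316·t`), level shift `≤ t/3` (census KAPPA-N)]. -/
def RecutBentW : Prop := AffineRecut ChartFamilyRW CompFamilyW bends0 tau0 tau1 kN1 kL0 T0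

/-- ★ **(ENVᴿ-bentW Ψ)** `:= PairedEnvelopeOn projectedFree 𝓘₀ᴿʷ 𝓘₁ʷ 𝓑₀ (1/4) (7/20) (2/5) T₀ Ψ` — decomposed at level 2 (§2). -/
def EnvelopeRBentW (Ψ : (M₁ : ℕ) → (Fin M₁ → E3) → Fin M₁ → ℝ → ℝ) : Prop :=
  PairedEnvelopeOn projectedFree ChartFamilyRW CompFamilyW bends0 tau0 tau1 kL0 T0 Ψ

/-- ★ **(DOMᴿ-bentW Ψ)** `:= RecutDomination 𝓘₀ᴿʷ 𝓘₁ʷ 𝓑₀ (1/3) (2/5) T₀ Ψ Φ₁` [TABLE CERTIFICATE · INSTRUMENTABLE: BUDGET54 = BUDGET53 on (chart box) × (recut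
ball), tables switched on the chart's fitted phase]. -/
def DominationRBentW (Ψ : (M₁ : ℕ) → (Fin M₁ → E3) → Fin M₁ → ℝ → ℝ) : Prop := RecutDomination ChartFamilyRW CompFamilyW bends0 kN1 kL0 T0 Ψ Phi1

/-- ★ **(F1ᴿ-cap-bentW)** `:= FamilyEnvelopeRecutCap 𝓘₀ᴿʷ 𝓘₁ʷ 𝓑₀ (1/4) (1/3) (2/5) Φ₁ T₀`. -/
def FamilyEnvelopeCapRBentW : Prop := FamilyEnvelopeRecutCap ChartFamilyRW CompFamilyW bends0 tau0 kN1 kL0 Phi1 T0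

/-- ★ **(F2ᴿ-bentW0)** `:= FamilyRoom 𝓘₀ᴿʷ (24/5) (1/100) (3/50) (1/4) T₀` [GEOMETRIC · INSTRUMENTABLE: (F2-bentW0) plus three columns — the fitted chart of a
far-class host has an interior presentation (`‖G₀ − 1‖ ≤ 9/50`, `‖ξ₀‖ ≤ 1/10`) whose bent lattice is `3/4`-separated on the `27/2`-window; census FOOTPRINT27 puts
admissible chart centres at strain `≤ 0.132`, `‖ξ‖ ≤ 0.053`, `d ≥ 0.877`]. -/
def FamilyRoomRBentW0 : Prop := FamilyRoom ChartFamilyRW (24 / 5) (1 / 100) etaE tau0 T0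

/-- ★ **(F3ᴿ-bentW)** `:= FamilyCertRecut 𝓘₀ᴿʷ 𝓘₁ʷ 𝓑₀ (1/3) (2/5) 0 Φ₁ T₀` [TABLE CERTIFICATE over recut pairs · INSTRUMENTABLE]. -/
def FamilyCertRBentW : Prop := FamilyCertRecut ChartFamilyRW CompFamilyW bends0 kN1 kL0 0 Phi1 T0

/-- ★ **(BASᴿ-bentW)** `:= PairedBasin projectedFree 𝓘₀ᴿʷ 𝓘₁ʷ 𝓑₀ (1/4) (7/20) (2/5) T₀ (1/20)` [ANALYTIC · UNDECIDED · INSTRUMENTABLE: census BASIN]. -/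
def BasinRBentW : Prop := PairedBasin projectedFree ChartFamilyRW CompFamilyW bends0 tau0 tau1 kL0 T0 delta0

/-- ★ **(MEMᴿ-bentW μ)** `:= PairedMembership 𝓘₀ᴿʷ 𝓘₁ʷ 𝓑₀ (1/4) (7/20) (2/5) T₀ (1/20) μ` [INSTRUMENTABLE: census MU on (chart box) × (recut ball)]. -/
def MembershipRBentW (μ : (M₁ : ℕ) → (Fin M₁ → E3) → Fin M₁ → ℝ) : Prop := PairedMembership ChartFamilyRW CompFamilyW bends0 tau0 tau1 kL0 T0 delta0 μ

/-- ★ **(LINᴿ-bentW Ψ)** `:= PairedSlaved projectedFree 𝓘₀ᴿʷ 𝓘₁ʷ 𝓑₀ (1/4) (7/20) (2/5) T₀ (1/20) G₀ w₀ Ψ` [MECHANICS · UNDECIDED · INSTRUMENTABLE: census LIN]. -/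
def SlavedRBentW (Ψ : (M₁ : ℕ) → (Fin M₁ → E3) → Fin M₁ → ℝ → ℝ) : Prop :=
  PairedSlaved projectedFree ChartFamilyRW CompFamilyW bends0 tau0 tau1 kL0 T0 delta0 G0 w0 Ψ

/-- ★★ LEVEL-2 NODE OF g54 (W): (BASᴿ-bentW) ∧ (T2ʷ) [OPEN: the g53 J proof re-run over `𝓘₁ʷ`] ∧ (MEMᴿ-bentW μ) ∧ (LINᴿ-bentW Ψ) ⟹ (ENVᴿ-bentW (Ψ + ϱ₀ + μ)). [folklore] -/
theorem envelopeRBentW_of_taylor {Ψ : (M₁ : ℕ) → (Fin M₁ → E3) → Fin M₁ → ℝ → ℝ} {μ : (M₁ : ℕ) → (Fin M₁ → E3) → Fin M₁ → ℝ} (hB : BasinRBentW)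
    (hT : TaylorTwoBentW) (hM : MembershipRBentW μ) (hL : SlavedRBentW Ψ) : EnvelopeRBentW (withColumns Ψ μ) :=
  pairedEnvelopeOn_of_taylor hB hT hM hL

/-- ★★ LEVEL-1 NODE OF g54 (W): (RFᴿ-bentW) ∧ (ENVᴿ-bentW Ψ) ∧ (DOMᴿ-bentW Ψ) ⟹ (F1ᴿ-cap-bentW). [folklore] -/
theorem familyEnvelopeCapRBentW_of_pieces {Ψ : (M₁ : ℕ) → (Fin M₁ → E3) → Fin M₁ → ℝ → ℝ} (hRF : RecutBentW) (hE : EnvelopeRBentW Ψ)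
    (hD : DominationRBentW Ψ) : FamilyEnvelopeCapRBentW :=
  familyEnvelopeRecutCap_of_pieces hRF hE hD

/-- ★★ LEVEL-0 NODE OF g54 (W), EDGE BAND: (F1ᴿ-cap-bentW) ∧ (F2ᴿ-bentW0) ∧ (F3ᴿ-bentW) ⟹ `EdgeFarFloor (63/10) (63/10) (24/5) (1/100) (3/50) 0`. [folklore] -/
theorem edgeFar_capRBentW (hE : FamilyEnvelopeCapRBentW) (hR : FamilyRoomRBentW0) (hC : FamilyCertRBentW) :
    EdgeFarFloor (63 / 10) (63 / 10) (24 / 5) (1 / 100) (3 / 50) 0 :=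
  edgeFar_of_familyRecutCap hE hR hC

/-- ★★★ THE g54 NODE OF RECORD (levels 2 + 1 + 0 on recut pairs, ten binders, every seam proved): for any tables `Ψ, μ`,
(BASᴿ-bentW) ∧ (T2ʷ) ∧ (MEMᴿ-bentW μ) ∧ (LINᴿ-bentW Ψ) ∧ (RFᴿ-bentW) ∧ (DOMᴿ-bentW (Ψ+ϱ₀+μ)) ∧ (F2ᴿ-bentW0) ∧ (F3ᴿ-bentW) ∧ [BRIDGE]
`BandFarFloor … (3/50) (1/10) 0` ∧ [SOFT-FAR] `SoftFarFloor … (1/10) 0` ⟹ [CORE-FAR] `CoreOffTubeFloor (63/10) (63/10) (24/5) (1/100) 0`. [folklore] -/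
theorem coreOff_record_g54W {Ψ : (M₁ : ℕ) → (Fin M₁ → E3) → Fin M₁ → ℝ → ℝ} {μ : (M₁ : ℕ) → (Fin M₁ → E3) → Fin M₁ → ℝ}
    (hB : BasinRBentW) (hT : TaylorTwoBentW) (hM : MembershipRBentW μ) (hL : SlavedRBentW Ψ) (hRF : RecutBentW)
    (hD : DominationRBentW (withColumns Ψ μ)) (hR : FamilyRoomRBentW0) (hC : FamilyCertRBentW)
    (hBand : BandFarFloor (63 / 10) (63 / 10) (24 / 5) (1 / 100) (3 / 50) (1 / 10) 0) (hS : SoftFarFloor (63 / 10) (63 / 10) (24 / 5) (1 / 100) (1 / 10) 0) :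
    CoreOffTubeFloor (63 / 10) (63 / 10) (24 / 5) (1 / 100) 0 :=
  coreOff_of_familyRecutCap_of_band_of_soft (familyEnvelopeCapRBentW_of_pieces hRF (envelopeRBentW_of_taylor hB hT hM hL) hD) hR hC hBand hS

/-- ★★ The EDGE band alone (no bridge, no residual): the eight pieces ⟹ `EdgeFarFloor (63/10) (63/10) (24/5) (1/100) (3/50) 0`. [folklore] -/
theorem edgeFar_record_g54W {Ψ : (M₁ : ℕ) → (Fin M₁ → E3) → Fin M₁ → ℝ → ℝ} {μ : (M₁ : ℕ) → (Fin M₁ → E3) → Fin M₁ → ℝ}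
    (hB : BasinRBentW) (hT : TaylorTwoBentW) (hM : MembershipRBentW μ) (hL : SlavedRBentW Ψ) (hRF : RecutBentW)
    (hD : DominationRBentW (withColumns Ψ μ)) (hR : FamilyRoomRBentW0) (hC : FamilyCertRBentW) :
    EdgeFarFloor (63 / 10) (63 / 10) (24 / 5) (1 / 100) (3 / 50) 0 :=
  edgeFar_capRBentW (familyEnvelopeCapRBentW_of_pieces hRF (envelopeRBentW_of_taylor hB hT hM hL) hD) hR hC


/-- (T2ʷ) also serves §A's node: with (T2ʷ) in hand, §A's (T2-bent₁) binder is discharged by antitonicity. [formal bookkeeping] -/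
theorem coreOff_record_g54_of_T2W {Ψ : (M₁ : ℕ) → (Fin M₁ → E3) → Fin M₁ → ℝ → ℝ} {μ : (M₁ : ℕ) → (Fin M₁ → E3) → Fin M₁ → ℝ}
    (hB : BasinRBent1) (hT : TaylorTwoBentW) (hM : MembershipRBent1 μ) (hL : SlavedRBent1 Ψ) (hRF : RecutBent1)
    (hD : DominationRBent1 (withColumns Ψ μ)) (hR : FamilyRoomRBent0) (hC : FamilyCertRBent1)
    (hBand : BandFarFloor (63 / 10) (63 / 10) (24 / 5) (1 / 100) (3 / 50) (1 / 10) 0) (hS : SoftFarFloor (63 / 10) (63 / 10) (24 / 5) (1 / 100) (1 / 10) 0) :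
    CoreOffTubeFloor (63 / 10) (63 / 10) (24 / 5) (1 / 100) 0 :=
  coreOff_record_g54 hB (taylorTwoBent1_of_W hT) hM hL hRF hD hR hC hBand hS

end Summit.AtomisticToContinuum.Crystallization.Theorems.FrustratedLawDichotomyStrainedPatchRecutRecord
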